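import Summits.Ventures.Crystal3D.Theorems.StickyWulffConstantGenericWallFloorEndBallClassInterface
import HarnessLib

/-!
# §51 interface — WORKED EXAMPLE on class G1 (`q3G1`, T-anchored, 8 contacts + 11 shell balls): its 20 free sites, evaluated in
# kernel, and the universe theorem for its carriers (crux `GenericWallFloor`, stmt-Ventures-19480, line `WallLedgerG`)

HONEST FRAMING. Venture `Summits/Ventures/Crystal3D` (cell `crystal3d-full`), helper for the crux `GenericWallFloor` of
`route-Ventures-StickyWulffConstant`, REGISTERED line `WallLedgerG`, open stub `stub_twoSlabAdhesion`.  TEMPLATE for cf-p2's per-class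
glue (PREREG-G-TWOCENTRE class G1 = `q3G1` of …ShellRowCertDefs, shell row `shellRow_G1`); one definition (`endBallClassG1`, the class in
interface format) + kernel evaluation of its free sites (`decide +kernel`) + the instantiated universe theorem.  The shell row enters as the
hypothesis `deg z ≤ 8` (it is `shellRow_G1`, computational grade, …ShellRowCert — kept out so that this file stays census-free).
Rung credit only; F-C1 not moved.

* `endBallClassG1 := ⟨q3G1.take 8, q3G1.drop 8⟩` (contacts = the 8 slots, own = the 11 shell balls), `endBallClassG1_wf`, `_listed`.
* **`freeSites_G1`** — `endBallClassG1.freeSites true` = the 20 sites `(±4,±4,±4)`-type (squared length `48`, distance `√(8/3)`: 4 of the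
  8 cube sites) and `(6,3,3)`-type (squared length `54`, distance `√3`: 16 sites); NO free slot site and nothing within `√(8/3)` except
  the four cube sites (enumeration HOME/wall-p1-g11/freesites.py agrees: G1 20 · G2 24 · G3 30 · G4 30 · G5 28 · G6 24 · G7 26 free sites,
  all of squared length 48 or 54).
* **`universe_G1`** — GAP/CLASS (`δ ≥ 5/2`), `X` `1`-separated, `z ∈ X` with the 19 balls `z + A·pointVec q` (`q ∈ q3G1`) present and
  `deg z ≤ 8`: every `x ∈ X` within `√3` of `z` is `z`, one of the 19, a ball at one of the 20 free sites, or has a payer `y ≠ z` within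
  `2` (`deg y ≤ 11`).
WHAT THIS IS NOT: not a certificate of anything new about G1; F-C1 not moved.
-/

namespace Summit.Ventures.Crystal3D.Theorems

open Summit.Ventures.Crystal3D Finset NearIdentity

/-- Class G1 in the §51 interface format: contacts = the first 8 entries of `q3G1` (its slots), own = the 11 shell balls. -/
def endBallClassG1 : EndBallClass := ⟨q3G1.take 8, q3G1.drop 8⟩

/-- G1 is well-formed (its contacts are eight distinct slots). -/
theorem endBallClassG1_wf : endBallClassG1.wf = true := by decide

/-- The listed balls of G1 are `q3G1`. -/
theorem endBallClassG1_listed : endBallClassG1.listed = q3G1 := List.take_append_drop 8 q3G1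

set_option maxRecDepth 200000 in
/-- **The free sites of G1**, evaluated: 4 cube sites at `√(8/3)` and 16 sites at `√3`. -/
theorem freeSites_G1 : endBallClassG1.freeSites true =
    {![-6, -3, -3],
    ![-6, -3, 3],
    ![-6, 3, -3],
    ![-6, 3, 3],
    ![-4, -4, -4],
    ![-4, -4, 4],
    ![-4, 4, 4],
    ![-3, -6, -3],
    ![-3, -6, 3],
    ![-3, -3, -6],
    ![-3, -3, 6],
    ![-3, 3, 6],
    ![-3, 6, 3],
    ![3, -6, -3],
    ![3, -6, 3],
    ![3, -3, 6],
    ![3, 6, -3],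
    ![4, -4, 4],
    ![6, -3, 3],
    ![6, 3, -3]} := by
  decide +kernel

variable {X : Finset (EuclideanSpace ℝ (Fin 3))}

/-- **Universe theorem for carriers of G1.** -/
theorem universe_G1 {δ : ℝ} (hg : KissingGap δ) (hc : KissingClassification δ) (hδ : 5 / 2 ≤ δ)
    (hX : ∀ p ∈ X, ∀ q ∈ X, p ≠ q → 1 ≤ dist p q)
    (A : EuclideanSpace ℝ (Fin 3) ≃ₗᵢ[ℝ] EuclideanSpace ℝ (Fin 3)) {z : EuclideanSpace ℝ (Fin 3)} (hz : z ∈ X)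
    (hpres : ∀ q ∈ q3G1, z + A (pointVec q) ∈ X) (hdeg : (X.filter fun y => dist z y = 1).card ≤ 8)
    {x : EuclideanSpace ℝ (Fin 3)} (hx : x ∈ X) (h3 : dist x z ≤ Real.sqrt 3) :
    x = z ∨ (∃ q ∈ q3G1, x = z + A (pointVec q)) ∨ (∃ q ∈ endBallClassG1.freeSites true, x = z + A (pointVec q)) ∨
      ∃ y ∈ X, y ≠ z ∧ dist x y ≤ 2 ∧ (X.filter fun q => dist y q = 1).card ≤ 11 := by
  have hcar : endBallClassG1.IsCarrier X A z := ⟨hz, by rw [endBallClassG1_listed]; exact hpres⟩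
  have hlen : endBallClassG1.contacts.length = 8 := by decide
  have h := endBallClassG1.universe_sharp endBallClassG1_wf hg hc hδ hX A hcar (by rw [hlen]; exact hdeg) hx h3
  rwa [endBallClassG1_listed] at h

end Summit.Ventures.Crystal3D.Theorems
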